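import Mathlib
import HarnessLib
import Summits.Ventures.LatticeQCDFlow.Exactness.CabibboMarinariCooling
import Summits.Ventures.LatticeQCDFlow.Exactness.OpenBoundaryWilsonAction
import Summits.Ventures.LatticeQCDFlow.Scoring.WeightedStapleSum

/-!
# Cabibbo–Marinari cooling with WEIGHTED staples never increases the weighted Wilson action (open boundaries, PTBC defect)

HONEST FRAMING: exact (Metropolis-corrected) sampling algorithms for lattice gauge theory;
figures of merit are autocorrelation/cost numbers at stated couplings and volumes; no
continuum-physics claim.

Venture `LatticeQCDFlow` (cell pub-lqcd), topic `Exactness`, FANOUT row 21 (`su3-base`: the row's `Q_L` is the clover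
charge after `n_cool` Cabibbo–Marinari cooling sweeps; with open boundaries the engine cools with WEIGHTED staples —
"HB/OR/Metropolis/HMC/flow all honour it (staple sums are weighted)").  NEW WORK of the cell over the tree (row 21's
`CabibboMarinariCooling`: the one-link hit `cmCool e R g = φ(ŝ⁻¹)g` maximises `Re tr (· R)` over its `SU(2)` coset,
`re_trace_coset_le_cmCool`, and the UNIT-weight lattice maps `cmLatCool` / `cmCoolSchedule` with `S_W` monotone;
row 21's `Scoring/WeightedStapleSum`: `weightedStapleSum`, `weightedWilsonAction_mulSingle_sub` — the exact local
difference for every weight).  Nothing is cited as a fact; no number.  (`G = SU(N)`, defining representation, torus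
`(ℤ/L)^d` with `L ≥ 2`, ANY plaquette weights `w`.)

* **`cmLatCoolW w e x μ`** — THE ENGINE'S WEIGHTED COOLING HIT: replace `U_{(x,μ)}` by `cmCool e (R^w_{(x,μ)}(U)) U_{(x,μ)}`;
  `cmLatCoolW_apply_self`, `cmLatCoolW_apply_of_ne`;
* **`weightedWilsonAction_cmLatCoolW_le_coset`** — the hit beats every point of its coset:
  `S_w(cmLatCoolW U) ≤ S_w(φ(A) ·_{(x,μ)} U)` for all `A ∈ SU(2)`; **`weightedWilsonAction_cmLatCoolW_le`** —
  `S_w(cmLatCoolW U) ≤ S_w(U)`;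
* **`cmCoolScheduleW w l`** — any schedule of weighted hits; `cmCoolScheduleW_append`;
  **`weightedWilsonAction_cmCoolScheduleW_le`** — `S_w` NEVER INCREASES along ANY weighted cooling schedule;
  `weightedWilsonAction_cmCoolScheduleW_append_le`;
* the open-boundary instances `obcAction_cmLatCoolW_le`, **`obcAction_cmCoolScheduleW_le`** (`w = obcWeight τ`).

NOT CLAIMED: convergence of the cooled configuration or of the charge; fixed points versus weighted-flow stationary
points (the unit-weight statement is `CabibboMarinariCoolingFixedPoints`); `L = 1`; floating point.
-/

noncomputable section

namespace Summit.Ventures.LatticeQCDFlow.Exactness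

open Matrix Function
open Literature.MathematicalPhysics.QuantumFieldTheory
open Summit.Ventures.LatticeQCDFlow.Scoring (weightedStapleSum weightedWilsonAction_mulSingle_sub)

section Lattice

variable {d L N : ℕ} {m : Type*} [Fintype m] [DecidableEq m] (w : Plaquette d L → ℝ)

/-- **The engine's weighted cooling hit** at link `(x, μ)` in the subgroup frame `e`: left-multiply the link by
`φ(ŝ⁻¹)`, `ŝ` the unit quaternion of the `e`-block of `U_{(x,μ)} R^w_{(x,μ)}(U)`, `R^w` the WEIGHTED staple sum. -/
def cmLatCoolW (e : Fin N ≃ Fin 2 ⊕ m) (x : Site d L) (μ : Fin d)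
    (U : GaugeConfig d L (Matrix.specialUnitaryGroup (Fin N) ℂ)) : GaugeConfig d L (Matrix.specialUnitaryGroup (Fin N) ℂ) :=
  Pi.mulSingle (x, μ) (blockEmbSU e (cmUnit e (weightedStapleSum w (suRep N) U x μ) (U (x, μ)))⁻¹) * U

/-- The hit link is the one-link cooling hit with the weighted staple sum. -/
theorem cmLatCoolW_apply_self (e : Fin N ≃ Fin 2 ⊕ m) (x : Site d L) (μ : Fin d)
    (U : GaugeConfig d L (Matrix.specialUnitaryGroup (Fin N) ℂ)) :
    cmLatCoolW w e x μ U (x, μ) = cmCool e (weightedStapleSum w (suRep N) U x μ) (U (x, μ)) := by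
  rw [cmLatCoolW, Pi.mul_apply, Pi.mulSingle_eq_same, cmCool]

/-- Off the link nothing moves. -/
theorem cmLatCoolW_apply_of_ne (e : Fin N ≃ Fin 2 ⊕ m) (x : Site d L) (μ : Fin d)
    (U : GaugeConfig d L (Matrix.specialUnitaryGroup (Fin N) ℂ)) {e' : Edge d L} (he : e' ≠ (x, μ)) :
    cmLatCoolW w e x μ U e' = U e' := by
  rw [cmLatCoolW, Pi.mul_apply, Pi.mulSingle_eq_of_ne he, one_mul]

variable [NeZero L]

/-- **The weighted hit beats every point of its coset**: `S_w(cmLatCoolW U) ≤ S_w(φ(A) ·_{(x,μ)} U)` for all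
`A ∈ SU(2)` (`L ≥ 2`: the weighted staple sum does not read the link it updates). -/
theorem weightedWilsonAction_cmLatCoolW_le_coset (hL : 2 ≤ L) (e : Fin N ≃ Fin 2 ⊕ m) (x : Site d L) (μ : Fin d)
    (U : GaugeConfig d L (Matrix.specialUnitaryGroup (Fin N) ℂ)) (A : Matrix.specialUnitaryGroup (Fin 2) ℂ) :
    weightedWilsonAction w (suRep N) (cmLatCoolW w e x μ U) ≤
      weightedWilsonAction w (suRep N) (Pi.mulSingle (x, μ) (blockEmbSU e A) * U) := by
  set R := weightedStapleSum w (suRep N) U x μ with hR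
  have h1 := weightedWilsonAction_mulSingle_sub w (suRep N) hL continuous_suRep U x μ
    (blockEmbSU e (cmUnit e R (U (x, μ)))⁻¹)
  have h2 := weightedWilsonAction_mulSingle_sub w (suRep N) hL continuous_suRep U x μ (blockEmbSU e A)
  have hle := re_trace_coset_le_cmCool e R A (U (x, μ))
  rw [cmCool] at hle
  rw [suRep_apply, suRep_apply] at h1 h2
  rw [cmLatCoolW, ← hR]
  linarith

/-- **The engine's weighted cooling hit never increases the weighted action**: `S_w(cmLatCoolW U) ≤ S_w(U)` (`L ≥ 2`). -/
theorem weightedWilsonAction_cmLatCoolW_le (hL : 2 ≤ L) (e : Fin N ≃ Fin 2 ⊕ m) (x : Site d L) (μ : Fin d)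
    (U : GaugeConfig d L (Matrix.specialUnitaryGroup (Fin N) ℂ)) :
    weightedWilsonAction w (suRep N) (cmLatCoolW w e x μ U) ≤ weightedWilsonAction w (suRep N) U := by
  have h := weightedWilsonAction_cmLatCoolW_le_coset w hL e x μ U 1
  rwa [map_one, Pi.mulSingle_one, one_mul] at h

omit [NeZero L] in
/-- **A weighted cooling schedule**: the weighted hits of a list of (link, frame) pairs applied in order. -/
def cmCoolScheduleW : List (Edge d L × (Fin N ≃ Fin 2 ⊕ m)) →
    GaugeConfig d L (Matrix.specialUnitaryGroup (Fin N) ℂ) → GaugeConfig d L (Matrix.specialUnitaryGroup (Fin N) ℂ)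
  | [] => id
  | (h :: t) => fun U => cmCoolScheduleW t (cmLatCoolW w h.2 h.1.1 h.1.2 U)

omit [NeZero L] in
/-- The empty schedule does nothing. -/
@[simp] theorem cmCoolScheduleW_nil (U : GaugeConfig d L (Matrix.specialUnitaryGroup (Fin N) ℂ)) :
    cmCoolScheduleW w ([] : List (Edge d L × (Fin N ≃ Fin 2 ⊕ m))) U = U := rfl

omit [NeZero L] in
/-- One hit, then the rest. -/
@[simp] theorem cmCoolScheduleW_cons (h : Edge d L × (Fin N ≃ Fin 2 ⊕ m)) (t : List (Edge d L × (Fin N ≃ Fin 2 ⊕ m)))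
    (U : GaugeConfig d L (Matrix.specialUnitaryGroup (Fin N) ℂ)) :
    cmCoolScheduleW w (h :: t) U = cmCoolScheduleW w t (cmLatCoolW w h.2 h.1.1 h.1.2 U) := rfl

omit [NeZero L] in
/-- Concatenated schedules compose. -/
theorem cmCoolScheduleW_append (l₁ l₂ : List (Edge d L × (Fin N ≃ Fin 2 ⊕ m)))
    (U : GaugeConfig d L (Matrix.specialUnitaryGroup (Fin N) ℂ)) :
    cmCoolScheduleW w (l₁ ++ l₂) U = cmCoolScheduleW w l₂ (cmCoolScheduleW w l₁ U) := by
  induction l₁ generalizing U with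
  | nil => rfl
  | cons h t ih => exact ih _

/-- **WEIGHTED COOLING NEVER INCREASES THE WEIGHTED ACTION, FOR EVERY SCHEDULE** (`L ≥ 2`). -/
theorem weightedWilsonAction_cmCoolScheduleW_le (hL : 2 ≤ L) (l : List (Edge d L × (Fin N ≃ Fin 2 ⊕ m)))
    (U : GaugeConfig d L (Matrix.specialUnitaryGroup (Fin N) ℂ)) :
    weightedWilsonAction w (suRep N) (cmCoolScheduleW w l U) ≤ weightedWilsonAction w (suRep N) U := by
  induction l generalizing U with
  | nil => exact le_rfl
  | cons h t ih => exact (ih _).trans (weightedWilsonAction_cmLatCoolW_le w hL h.2 h.1.1 h.1.2 U)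

/-- **More cooling never increases the weighted action either**: continuing a schedule `l₁` by `l₂`. -/
theorem weightedWilsonAction_cmCoolScheduleW_append_le (hL : 2 ≤ L) (l₁ l₂ : List (Edge d L × (Fin N ≃ Fin 2 ⊕ m)))
    (U : GaugeConfig d L (Matrix.specialUnitaryGroup (Fin N) ℂ)) :
    weightedWilsonAction w (suRep N) (cmCoolScheduleW w (l₁ ++ l₂) U) ≤
      weightedWilsonAction w (suRep N) (cmCoolScheduleW w l₁ U) := by
  rw [cmCoolScheduleW_append]
  exact weightedWilsonAction_cmCoolScheduleW_le w hL l₂ _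

/-! ### Open boundaries -/

/-- **Open boundaries**: one weighted cooling hit never increases `S_OBC` (time direction `τ`, `L ≥ 2`). -/
theorem obcAction_cmLatCoolW_le (hL : 2 ≤ L) (τ : Fin d) (e : Fin N ≃ Fin 2 ⊕ m) (x : Site d L) (μ : Fin d)
    (U : GaugeConfig d L (Matrix.specialUnitaryGroup (Fin N) ℂ)) :
    obcAction (suRep N) τ (cmLatCoolW (obcWeight τ) e x μ U) ≤ obcAction (suRep N) τ U :=
  weightedWilsonAction_cmLatCoolW_le (obcWeight τ) hL e x μ U

/-- **Open boundaries: `S_OBC` never increases along any open-boundary cooling schedule** (`L ≥ 2`). -/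
theorem obcAction_cmCoolScheduleW_le (hL : 2 ≤ L) (τ : Fin d) (l : List (Edge d L × (Fin N ≃ Fin 2 ⊕ m)))
    (U : GaugeConfig d L (Matrix.specialUnitaryGroup (Fin N) ℂ)) :
    obcAction (suRep N) τ (cmCoolScheduleW (obcWeight τ) l U) ≤ obcAction (suRep N) τ U :=
  weightedWilsonAction_cmCoolScheduleW_le (obcWeight τ) hL l U

end Lattice

end Summit.Ventures.LatticeQCDFlow.Exactness
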